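import Literature.NumberTheory.GaloisRepresentations.BiquadraticReciprocityRationalInteger
import HarnessLib

/-!
# The composite quartic symbol under Galois conjugation and at the units `i`, `-1`
# (Ireland–Rosen Prop. 14.2.4; Ch. 18 §6 «`(i/α)₄ = i^{(Nα-1)/4}`»; Prop. 9.8.3 (d) for primary `α`)

Topic `NumberTheory/GaloisRepresentations`; namespace `Literature.NumberTheory.GaloisRepresentations`.
Theorems only (no definition, no named fact; net Literature debt 0).  Supplements
`QuarticResidueSymbolComposite.lean` (`quarticSymbol 𝔞 β = (β/𝔞)₄ = ∏_{P^e ∥ 𝔞} χ_P(β)^e`, Ireland–Rosen's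
`χ_α(β) = quarticSymbol (Ideal.span {α}) β`) with the facts about the composite symbol that the proof of the
general law of biquadratic reciprocity (Prop. 9.9.9 / Theorem 2) consumes.

Sources (held text `book:ireland1982-classical-introduction-modern-number-theory`):
* Ch. 14 §2 (chunk p0210), **Prop. 14.2.4** «Let `A` be an ideal prime to `m` and `σ ∈ G`. Then `(α/A)_m^σ =
  (α^σ/A^σ)_m`.» (here `m = 4`, `G = Gal(ℚ(i)/ℚ)`, and more generally any ring automorphism of `𝓞 K`);
* Ch. 18 §6 (p. 311, chunk p0303–p0304): «`(i/α)₄ = i^{(Nα-1)/4}`» for `α ≡ 1 (2 + 2i)` — the composite version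
  of the Corollary to Prop. 14.2.2 («`(ζ_m/P)_m = ζ_m^{(NP-1)/m}`»); squaring, `(-1/α)₄ = (-1)^{(Nα-1)/4}`;
* Ch. 9 §8 **Prop. 9.8.3 (d)** «If `π` is a primary irreducible then `χ_π(-1) = (-1)^{(a-1)/2}`, where `π = a +
  bi`», extended to every primary `α = a + bi` by multiplicativity (§9, proof of Prop. 9.9.9: «noting that
  `χ_α(ε(x)) = χ_ᾱ(ε(x))`»), and **Prop. 9.8.5** read without the coprimality hypothesis: `χ_a(α) ∈ {0, 1}` for
  `a` odd and `α ∈ ℤ` (its proof gives `χ_q(α) ∈ {0,1}`, `χ_p(α) = χ_π(α) \overline{χ_π(α)} ∈ {0, 1}`).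

## Contents
§1 (any number field `K ∋ ζ₄`):
* `quarticSymbol_bot`; **`quarticSymbol_map_ringEquiv`** — Prop. 14.2.4: `(σβ/σ𝔞)₄ = σ((β/𝔞)₄)` for every ring
  automorphism `σ` of `𝓞 K` (prime by prime from `quarticResidueSymbol_mk_map_ringEquiv`, Prop. 9.8.3 (c));
  `quarticSymbol_span_map_ringEquiv` (`χ_{σα}(σβ) = σ(χ_α(β))`);
* `quarticSymbol_eq_zero_or_pow_four_eq_one` (values in `{0} ∪ μ₄`), **`quarticSymbol_pow_four_eq_one`** (`(β/𝔞)₄⁴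
  = 1` when `β` and `2` lie in no prime factor of `𝔞`), `quarticSymbol_span_pow_four_eq_one` (`χ_α(β)⁴ = 1` for
  `α` primary and `(α, β) = 1`), `quarticSymbol_pow_right` (`(βⁿ/𝔞)₄ = (β/𝔞)₄ⁿ`, `𝔞` prime to `2`);
* **`quarticSymbol_self_eq_pow`** — «`(i/𝔞)₄ = i^{(N𝔞-1)/4}`» (with `4 ∣ N𝔞 - 1`) for every nonzero `𝔞` prime to
  `2`; **`quarticSymbol_neg_one_eq_pow`** — `(-1/𝔞)₄ = (-1)^{(N𝔞-1)/4}`.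
§2 (`K = ℚ(i)`, `IsCyclotomicExtension {4} ℚ K`):
* **`quarticSymbol_span_neg_one_of_primary`** — Prop. 9.8.3 (d) for every primary `α = a + bζ`: `χ_α(-1) =
  (-1)^{(a-1)/2}` (exponent through `Int.natAbs`); `quarticSymbol_span_neg_one_pow_of_primary` (`χ_α((-1)^k)`);
* `galRestrict_quarticSymbol` (`σ̂((β/𝔞)₄) = (β/𝔞)₄³` for the non-trivial `σ ∈ Gal(ℚ(i)/ℚ)`),
  `quarticSymbol_span_galRestrict` (`χ_{σ̂α}(σ̂β) = χ_α(β)³`);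
* (`K : Type`) **`quarticSymbol_span_intCast_intCast_eq_zero_or_eq_one`** — `χ_a(α) ∈ {0, 1}` for `a ∈ ℤ` odd and
  `α ∈ ℤ` (Prop. 9.8.5 without `(a, α) = 1`).

## References
* K. Ireland, M. Rosen, *A Classical Introduction to Modern Number Theory* (1982), Ch. 9 §8 Props. 9.8.3–9.8.5,
  §9 proof of Prop. 9.9.9 (chunks p0129–p0133); Ch. 14 §2 Prop. 14.2.2 Cor., Prop. 14.2.4 (chunks p0209–p0210);
  Ch. 18 §6 p. 311 (chunk p0304). [IrelandRosen1982]

## Mathlib / tree search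
Tree: `quarticSymbol_def/_top/_mul/_mul_right/_asIdeal/_span_neg/_span_mul/_span_of_span_eq` and
`quarticSymbol_span_natCast_of_mod_four_eq_one`, `inertPlace`, `galRestrict_quarticResidueSymbol`
(`QuarticResidueSymbolComposite`); `quarticSymbol_one_right`, `two_not_mem_of_mem_of_sub_one_mem_span`
(`BiquadraticReciprocityRationalInteger`); `quarticResidueSymbol_mk_map_ringEquiv`, `sq_add_sq_sub_one_div_four_emod_two`
(`QuarticResidueSymbolEulerCriterion`); `quarticResidueSymbol_spec/_mk_self/_eq_zero_or_pow_four/_zero/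
_intCast_eq_one_of_residueCard_eq_sq`, `four_dvd_residueCard_sub_one` (`QuarticResidueSymbol`);
`algEquiv_apply_eq_pow_three_of_pow_four` (`QuarticJacobiSumPrimary`); `norm_int_add_int_mul_four`,
`int_add_int_mul_sub_one_mem_span_iff_four`, `exists_algEquiv_ne_one_four`, `units_eq_one_of_sub_one_mem_span_four`.
Mathlib: `UniqueFactorizationMonoid.induction_on_prime`, `Ideal.map_isPrime_of_equiv`, `Ideal.map_span`,
`Nat.recOnMul`, `Multiset.prod_map_pow`; no composite power-residue symbol in Mathlib (`rg quarticSymbol` = tree only).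
-/

noncomputable section

namespace Literature.NumberTheory.GaloisRepresentations

open NumberField IsDedekindDomain UniqueFactorizationMonoid

/-! ### §1 Galois equivariance, values, and the units `i`, `-1` -/

section General

variable {K : Type*} [Field K] [NumberField K]
variable {ζ : 𝓞 K} (hζ : IsPrimitiveRoot ζ 4)

/-- `(β/⊥)₄ = 1` (junk: the zero ideal has the empty factorisation). [cite: IrelandRosen1982, Ch. 14 §2, Definition] -/
theorem quarticSymbol_bot (β : 𝓞 K) : quarticSymbol (⊥ : Ideal (𝓞 K)) β = 1 := by
  classical
  rw [quarticSymbol_def, ← Submodule.zero_eq_bot, normalizedFactors_zero, Multiset.map_zero, Multiset.prod_zero]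

include hζ in
/-- **Ireland–Rosen Prop. 14.2.4: «`(α/A)_m^σ = (α^σ/A^σ)_m`»** for `m = 4`: for every ring automorphism `σ` of
`𝓞 K`, every ideal `𝔞` and every `β`, `(σβ/σ𝔞)₄ = σ((β/𝔞)₄)` (prime by prime this is Prop. 9.8.3 (c),
`quarticResidueSymbol_mk_map_ringEquiv`; then multiply over the factorisation).
[cite: IrelandRosen1982, Ch. 14 §2, Prop. 14.2.4; Ch. 9 §8, Prop. 9.8.3 (c)] -/
theorem quarticSymbol_map_ringEquiv (σ : 𝓞 K ≃+* 𝓞 K) (𝔞 : Ideal (𝓞 K)) (β : 𝓞 K) :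
    quarticSymbol (𝔞.map (σ : 𝓞 K →+* 𝓞 K)) (σ β) = σ (quarticSymbol 𝔞 β) := by
  classical
  induction 𝔞 using UniqueFactorizationMonoid.induction_on_prime with
  | h₁ =>
    rw [Submodule.zero_eq_bot, Ideal.map_bot, quarticSymbol_bot, quarticSymbol_bot, map_one]
  | h₂ 𝔞 h𝔞 =>
    rw [Ideal.isUnit_iff.mp h𝔞, Ideal.map_top, quarticSymbol_top, quarticSymbol_top, map_one]
  | h₃ 𝔞 P h𝔞 hP ih =>
    have hP0 : P ≠ ⊥ := hP.ne_zero
    have hP' : P.IsPrime := Ideal.isPrime_of_prime hP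
    have h𝔞0 : 𝔞 ≠ ⊥ := h𝔞
    have hinj : Function.Injective (σ : 𝓞 K →+* 𝓞 K) := σ.injective
    have hmP0 : P.map (σ : 𝓞 K →+* 𝓞 K) ≠ ⊥ := by
      rwa [Ne, Ideal.map_eq_bot_iff_of_injective hinj]
    have hm𝔞0 : 𝔞.map (σ : 𝓞 K →+* 𝓞 K) ≠ ⊥ := by
      rwa [Ne, Ideal.map_eq_bot_iff_of_injective hinj]
    haveI hmP' : (P.map (σ : 𝓞 K →+* 𝓞 K)).IsPrime := Ideal.map_isPrime_of_equiv σ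
    let v : HeightOneSpectrum (𝓞 K) := ⟨P, hP', hP0⟩
    let v' : HeightOneSpectrum (𝓞 K) := ⟨P.map (σ : 𝓞 K →+* 𝓞 K), hmP', hmP0⟩
    have hvv' : v'.asIdeal = v.asIdeal.map σ := rfl
    rw [Ideal.map_mul, quarticSymbol_mul hmP0 hm𝔞0, quarticSymbol_mul hP0 h𝔞0, map_mul, ih,
      show P = v.asIdeal from rfl, quarticSymbol_asIdeal, show v.asIdeal.map (σ : 𝓞 K →+* 𝓞 K) = v'.asIdeal from rfl,
      quarticSymbol_asIdeal, quarticResidueSymbol_mk_map_ringEquiv hζ σ hvv' β]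

include hζ in
/-- Prop. 14.2.4 for a principal modulus: `(σβ/(σα))₄ = σ((β/(α))₄)`, i.e. `χ_{σα}(σβ) = σ(χ_α(β))`
(«`\overline{χ_π(α)} = χ_{π̄}(ᾱ)`» for `σ` = complex conjugation). [cite: IrelandRosen1982, Ch. 14 §2, Prop. 14.2.4; Ch. 9 §8, Prop. 9.8.3 (c)] -/
theorem quarticSymbol_span_map_ringEquiv (σ : 𝓞 K ≃+* 𝓞 K) (α β : 𝓞 K) :
    quarticSymbol (Ideal.span {σ α}) (σ β) = σ (quarticSymbol (Ideal.span {α}) β) := by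
  rw [← quarticSymbol_map_ringEquiv hζ σ, Ideal.map_span, Set.image_singleton]
  rfl

omit [NumberField K] in
/-- A product over a multiset whose factors are `0` or fourth roots of unity is `0` or a fourth root of unity. [folklore] -/
private theorem multiset_prod_eq_zero_or_pow_four {ι : Type*} (s : Multiset ι) (f : ι → 𝓞 K)
    (h : ∀ i ∈ s, f i = 0 ∨ f i ^ 4 = 1) : (s.map f).prod = 0 ∨ (s.map f).prod ^ 4 = 1 := by
  induction s using Multiset.induction_on with
  | empty => exact Or.inr (by rw [Multiset.map_zero, Multiset.prod_zero, one_pow])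
  | cons a s ih =>
    rw [Multiset.map_cons, Multiset.prod_cons]
    rcases h a (Multiset.mem_cons_self a s) with ha | ha
    · exact Or.inl (by rw [ha, zero_mul])
    rcases ih (fun i hi => h i (Multiset.mem_cons_of_mem hi)) with hs | hs
    · exact Or.inl (by rw [hs, mul_zero])
    · exact Or.inr (by rw [mul_pow, ha, hs, one_mul])

include hζ in
/-- The values of `(β/𝔞)₄` are `0` or fourth roots of unity. [cite: IrelandRosen1982, Ch. 9 §8, Definition after Prop. 9.8.4; Ch. 14 §2, Definition] -/
theorem quarticSymbol_eq_zero_or_pow_four_eq_one (𝔞 : Ideal (𝓞 K)) (β : 𝓞 K) :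
    quarticSymbol 𝔞 β = 0 ∨ quarticSymbol 𝔞 β ^ 4 = 1 := by
  classical
  rw [quarticSymbol_def]
  refine multiset_prod_eq_zero_or_pow_four _ _ fun P hP => ?_
  have hPp : Prime P := prime_of_normalized_factor P hP
  rw [quarticResidueSymbolIdeal_of_isPrime (Ideal.isPrime_of_prime hPp) hPp.ne_zero]
  exact quarticResidueSymbol_eq_zero_or_pow_four hζ _ _

include hζ in
/-- **`(β/𝔞)₄⁴ = 1`** when no prime factor of `𝔞` contains `β` or `2` («if `(α, β) = 1`» the symbol is a fourth
root of unity; `2 ∉ P` excludes the prime `(1 + i)` where `χ` is undefined). [cite: IrelandRosen1982, Ch. 9 §8, Definition after Prop. 9.8.4] -/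
theorem quarticSymbol_pow_four_eq_one {𝔞 : Ideal (𝓞 K)} {β : 𝓞 K}
    (h2 : ∀ v : HeightOneSpectrum (𝓞 K), 𝔞 ≤ v.asIdeal → (2 : 𝓞 K) ∉ v.asIdeal)
    (hβ : ∀ v : HeightOneSpectrum (𝓞 K), 𝔞 ≤ v.asIdeal → β ∉ v.asIdeal) :
    quarticSymbol 𝔞 β ^ 4 = 1 := by
  classical
  rw [quarticSymbol_def, ← Multiset.prod_map_pow]
  refine Multiset.prod_eq_one fun x hx => ?_
  obtain ⟨P, hP, rfl⟩ := Multiset.mem_map.mp hx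
  have hPp : Prime P := prime_of_normalized_factor P hP
  have hP' : P.IsPrime := Ideal.isPrime_of_prime hPp
  have hP0 : P ≠ ⊥ := hPp.ne_zero
  have hle : 𝔞 ≤ P := Ideal.le_of_dvd (dvd_of_mem_normalizedFactors hP)
  show quarticResidueSymbolIdeal P β ^ 4 = 1
  rw [quarticResidueSymbolIdeal_of_isPrime hP' hP0]
  refine (quarticResidueSymbol_spec hζ (h2 ⟨P, hP', hP0⟩ hle) ?_).1
  rw [Ne, Ideal.Quotient.eq_zero_iff_mem]
  exact hβ ⟨P, hP', hP0⟩ hle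

include hζ in
/-- **`χ_α(β)⁴ = 1` for `α` primary and `(α, β) = 1`** (then `β` and `2` lie in no prime factor of `(α)`).
[cite: IrelandRosen1982, Ch. 9 §8, Definition after Prop. 9.8.4] -/
theorem quarticSymbol_span_pow_four_eq_one {α β : 𝓞 K} (hα : α - 1 ∈ Ideal.span {(2 + 2 * ζ : 𝓞 K)})
    (hcop : IsCoprime α β) : quarticSymbol (Ideal.span {α}) β ^ 4 = 1 := by
  refine quarticSymbol_pow_four_eq_one hζ (fun v hv => ?_) (fun v hv hβ => ?_)
  · exact two_not_mem_of_mem_of_sub_one_mem_span ((Ideal.span_singleton_le_iff_mem _).mp hv) hα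
  · have hα' : α ∈ v.asIdeal := (Ideal.span_singleton_le_iff_mem _).mp hv
    obtain ⟨x, y, hxy⟩ := hcop
    exact v.isPrime.ne_top ((Ideal.eq_top_iff_one _).mpr
      (hxy ▸ v.asIdeal.add_mem (v.asIdeal.mul_mem_left _ hα') (v.asIdeal.mul_mem_left _ hβ)))

include hζ in
/-- `(βⁿ/𝔞)₄ = (β/𝔞)₄ⁿ` for `𝔞` prime to `2` (Prop. 14.2.3 (a) iterated; `n = 0` is `(1/𝔞)₄ = 1`).
[cite: IrelandRosen1982, Ch. 14 §2, Prop. 14.2.3 (a); Ch. 9 §8, Prop. 9.8.3 (b)] -/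
theorem quarticSymbol_pow_right {𝔞 : Ideal (𝓞 K)}
    (h2 : ∀ v : HeightOneSpectrum (𝓞 K), 𝔞 ≤ v.asIdeal → (2 : 𝓞 K) ∉ v.asIdeal) (β : 𝓞 K) (n : ℕ) :
    quarticSymbol 𝔞 (β ^ n) = quarticSymbol 𝔞 β ^ n := by
  induction n with
  | zero => rw [pow_zero, pow_zero, quarticSymbol_one_right hζ h2]
  | succ n ih => rw [pow_succ, pow_succ, quarticSymbol_mul_right hζ, ih]

omit [NumberField K] in
/-- `(mn - 1)/4 = (m - 1)/4 + (n - 1)/4 + 4 · ((m-1)/4) ((n-1)/4)` for `m ≡ n ≡ 1 (4)` (Exercise 44). [cite: IrelandRosen1982, Ch. 9, Exercise 44] -/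
private theorem mul_sub_one_div_four {m n : ℕ} (hm : 4 ∣ m - 1) (hn : 4 ∣ n - 1) (hm1 : 1 ≤ m) (hn1 : 1 ≤ n) :
    4 ∣ m * n - 1 ∧ (m * n - 1) / 4 = (m - 1) / 4 + (n - 1) / 4 + 4 * ((m - 1) / 4) * ((n - 1) / 4) := by
  obtain ⟨k, hk⟩ := hm
  obtain ⟨l, hl⟩ := hn
  have hm' : m = 4 * k + 1 := by omega
  have hn' : n = 4 * l + 1 := by omega
  have hkl : m * n - 1 = 4 * (k + l + 4 * k * l) := by
    rw [hm', hn']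
    have : (4 * k + 1) * (4 * l + 1) = 4 * (k + l + 4 * k * l) + 1 := by ring
    omega
  refine ⟨⟨_, hkl⟩, ?_⟩
  rw [hkl, hk, hl, Nat.mul_div_cancel_left _ (by norm_num : 0 < 4), Nat.mul_div_cancel_left _ (by norm_num : 0 < 4),
    Nat.mul_div_cancel_left _ (by norm_num : 0 < 4)]

include hζ in
/-- **«`(i/α)₄ = i^{(Nα-1)/4}`»** (Ireland–Rosen Ch. 18 §6), for every nonzero ideal `𝔞` prime to `2`:
`4 ∣ N𝔞 - 1` and `(ζ/𝔞)₄ = ζ^{(N𝔞-1)/4}` — prime by prime the Corollary to Prop. 14.2.2 / `χ_P(i) = i^{(NP-1)/4}`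
(tree `quarticResidueSymbol_mk_self`), and `(mn-1)/4 ≡ (m-1)/4 + (n-1)/4 (mod 4)` for `m ≡ n ≡ 1 (4)`.
[cite: IrelandRosen1982, Ch. 18 §6 p. 311; Ch. 14 §2, Corollary to Prop. 14.2.2] -/
theorem quarticSymbol_self_eq_pow {𝔞 : Ideal (𝓞 K)} (h0 : 𝔞 ≠ ⊥)
    (h2 : ∀ v : HeightOneSpectrum (𝓞 K), 𝔞 ≤ v.asIdeal → (2 : 𝓞 K) ∉ v.asIdeal) :
    4 ∣ Ideal.absNorm 𝔞 - 1 ∧ quarticSymbol 𝔞 ζ = ζ ^ ((Ideal.absNorm 𝔞 - 1) / 4) := by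
  classical
  revert h0 h2
  induction 𝔞 using UniqueFactorizationMonoid.induction_on_prime with
  | h₁ => intro h0; exact absurd (Submodule.zero_eq_bot (M := 𝓞 K) (R := 𝓞 K)) h0
  | h₂ 𝔞 h𝔞 =>
    intro _ _
    rw [Ideal.isUnit_iff.mp h𝔞, quarticSymbol_top, Ideal.absNorm_top]
    exact ⟨dvd_zero 4, by rw [Nat.sub_self, Nat.zero_div, pow_zero]⟩
  | h₃ 𝔞 P h𝔞 hP ih =>
    intro _ h2
    -- replace the prime ideal `P` by the place `v` with `v.asIdeal = P`
    obtain ⟨v, rfl⟩ : ∃ v : HeightOneSpectrum (𝓞 K), v.asIdeal = P :=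
      ⟨⟨P, Ideal.isPrime_of_prime hP, hP.ne_zero⟩, rfl⟩
    have h2P : (2 : 𝓞 K) ∉ v.asIdeal := h2 v Ideal.mul_le_right
    have h2𝔞 : ∀ w : HeightOneSpectrum (𝓞 K), 𝔞 ≤ w.asIdeal → (2 : 𝓞 K) ∉ w.asIdeal :=
      fun w hw => h2 w (le_trans Ideal.mul_le_left hw)
    obtain ⟨hdvd𝔞, h𝔞ζ⟩ := ih h𝔞 h2𝔞
    have hdvdP : 4 ∣ v.residueCard - 1 := four_dvd_residueCard_sub_one hζ h2P
    have hP1 : 1 ≤ v.residueCard := Nat.one_le_iff_ne_zero.mpr (Ideal.absNorm_eq_zero_iff.not.mpr v.ne_bot)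
    have h𝔞1 : 1 ≤ Ideal.absNorm 𝔞 := Nat.one_le_iff_ne_zero.mpr (Ideal.absNorm_eq_zero_iff.not.mpr h𝔞)
    obtain ⟨hdvd, hsum⟩ := mul_sub_one_div_four hdvdP hdvd𝔞 hP1 h𝔞1
    have hN : Ideal.absNorm (v.asIdeal * 𝔞) = v.residueCard * Ideal.absNorm 𝔞 := by
      rw [map_mul, HeightOneSpectrum.residueCard]
    rw [hN]
    refine ⟨hdvd, ?_⟩
    rw [quarticSymbol_mul v.ne_bot h𝔞, quarticSymbol_asIdeal, quarticResidueSymbol_mk_self hζ h2P, h𝔞ζ, hsum,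
      pow_add, pow_add, mul_assoc 4, pow_mul, hζ.pow_eq_one, one_pow, mul_one]

include hζ in
/-- **`(-1/𝔞)₄ = (-1)^{(N𝔞-1)/4}`** for every nonzero ideal `𝔞` prime to `2` (`-1 = i²`, so this is the square of
«`(i/α)₄ = i^{(Nα-1)/4}`»; at a prime it is `quarticResidueSymbol_neg_one`). [cite: IrelandRosen1982, Ch. 18 §6 p. 311; Ch. 9 §8, Prop. 9.8.3 (d)] -/
theorem quarticSymbol_neg_one_eq_pow {𝔞 : Ideal (𝓞 K)} (h0 : 𝔞 ≠ ⊥)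
    (h2 : ∀ v : HeightOneSpectrum (𝓞 K), 𝔞 ≤ v.asIdeal → (2 : 𝓞 K) ∉ v.asIdeal) :
    quarticSymbol 𝔞 (-1) = (-1) ^ ((Ideal.absNorm 𝔞 - 1) / 4) := by
  have hζ2 : ζ ^ 2 = -1 := (hζ.pow (by norm_num) (show 4 = 2 * 2 by norm_num)).eq_neg_one_of_two_right
  obtain ⟨-, h⟩ := quarticSymbol_self_eq_pow hζ h0 h2
  have h1 : quarticSymbol 𝔞 (-1) = quarticSymbol 𝔞 (ζ * ζ) := by rw [← sq, hζ2]
  rw [h1, quarticSymbol_mul_right hζ, h, ← pow_two, ← pow_mul, pow_mul', hζ2]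

end General

/-! ### §2 `ℤ[i]`: `χ_α(-1) = (-1)^{(a-1)/2}` for primary `α = a + bi`, and `χ_a(α) ∈ {0, 1}` for `a, α ∈ ℤ` -/

section Gaussian

variable {K : Type*} [Field K] [NumberField K] [IsCyclotomicExtension {4} ℚ K]
variable {ζ : 𝓞 K} (hζ : IsPrimitiveRoot ζ 4)
include hζ

/-- **Prop. 9.8.3 (d) for every primary `α = a + bi`: `χ_α(-1) = (-1)^{(a-1)/2}`** («If `π` is a primary
irreducible then `χ_π(-1) = (-1)^{(a-1)/2}`»; for a primary product the real parts multiply modulo `4`, and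
the proof of Prop. 9.9.9 uses it in the form «`χ_α(ε(x)) = χ_ᾱ(ε(x))`»).  Via `(-1/(α))₄ = (-1)^{(Nα-1)/4}`,
`Nα = a² + b²`, and Lemma 6's parity `(a² + b² - 1)/4 ≡ (a - 1)/2 (mod 2)`; the `ℤ`-exponent is rendered through
`Int.natAbs`, which preserves parity. [cite: IrelandRosen1982, Ch. 9 §8, Prop. 9.8.3 (d); §9, proof of Prop. 9.9.9] -/
theorem quarticSymbol_span_neg_one_of_primary {a b : ℤ}
    (hprim : (a : 𝓞 K) + b * ζ - 1 ∈ Ideal.span {(2 + 2 * ζ : 𝓞 K)}) :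
    quarticSymbol (Ideal.span {(a : 𝓞 K) + b * ζ}) (-1) = (-1) ^ ((a - 1) / 2).natAbs := by
  set x : 𝓞 K := (a : 𝓞 K) + b * ζ with hx
  have hx0 : x ≠ 0 := by
    rintro h0
    rw [h0, zero_sub] at hprim
    have htop : Ideal.span {(2 + 2 * ζ : 𝓞 K)} = ⊤ := by
      rw [Ideal.eq_top_iff_one]
      have h' := (Ideal.span {(2 + 2 * ζ : 𝓞 K)}).neg_mem hprim
      rwa [neg_neg] at h'
    have hu := units_eq_one_of_sub_one_mem_span_four hζ (hζ.isUnit (by norm_num)).unit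
      (by rw [htop]; exact Submodule.mem_top)
    have h1 : ζ = 1 := by
      have h' := congrArg (fun u : (𝓞 K)ˣ => (u : 𝓞 K)) hu
      simpa using h'
    exact hζ.ne_one (by norm_num) h1
  have h0 : Ideal.span {x} ≠ ⊥ := by rwa [Ne, Ideal.span_singleton_eq_bot]
  have h2 : ∀ v : HeightOneSpectrum (𝓞 K), Ideal.span {x} ≤ v.asIdeal → (2 : 𝓞 K) ∉ v.asIdeal :=
    fun v hv => two_not_mem_of_mem_of_sub_one_mem_span ((Ideal.span_singleton_le_iff_mem _).mp hv) hprim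
  rw [quarticSymbol_neg_one_eq_pow hζ h0 h2, Ideal.absNorm_span_singleton,
    _root_.Literature.NumberTheory.NumberFields.norm_int_add_int_mul_four hζ a b, neg_one_pow_eq_pow_mod_two,
    neg_one_pow_eq_pow_mod_two (R := 𝓞 K) (n := ((a - 1) / 2).natAbs)]
  congr 1
  have hab := (_root_.Literature.NumberTheory.NumberFields.int_add_int_mul_sub_one_mem_span_iff_four hζ a b).mp hprim
  have hpar := sq_add_sq_sub_one_div_four_emod_two hab
  have hnn : (0 : ℤ) ≤ a ^ 2 + b ^ 2 := by positivity
  have hcast : (((a ^ 2 + b ^ 2).natAbs - 1) / 4 : ℕ) = (((a ^ 2 + b ^ 2 - 1) / 4 : ℤ)).natAbs := by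
    have h1 : (1 : ℤ) ≤ a ^ 2 + b ^ 2 := by
      have ha0 : a ≠ 0 := by rcases hab with ⟨ha, -⟩ | ⟨ha, -⟩ <;> omega
      have ha2 : 0 < a ^ 2 := sq_pos_iff.mpr ha0
      linarith [sq_nonneg b]
    omega
  rw [hcast]
  omega

/-- `χ_α((-1)^k) = (-1)^{((a-1)/2)·k}` for primary `α = a + bi` (Prop. 9.8.3 (d) and multiplicativity; the form in
which the proof of Prop. 9.9.9 evaluates `χ_α(ε(x))`, `ε(x) = (-1)^{(x-1)/2}`). [cite: IrelandRosen1982, Ch. 9 §8, Prop. 9.8.3 (b), (d); §9, proof of Prop. 9.9.9] -/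
theorem quarticSymbol_span_neg_one_pow_of_primary {a b : ℤ}
    (hprim : (a : 𝓞 K) + b * ζ - 1 ∈ Ideal.span {(2 + 2 * ζ : 𝓞 K)}) (k : ℕ) :
    quarticSymbol (Ideal.span {(a : 𝓞 K) + b * ζ}) ((-1) ^ k) = (-1) ^ (((a - 1) / 2).natAbs * k) := by
  rw [quarticSymbol_pow_right hζ (fun v hv =>
      two_not_mem_of_mem_of_sub_one_mem_span ((Ideal.span_singleton_le_iff_mem _).mp hv) hprim),
    quarticSymbol_span_neg_one_of_primary hζ hprim, ← pow_mul]

/-- Over `ℚ(i)`, complex conjugation cubes the values of the composite symbol: `σ̂((β/𝔞)₄) = (β/𝔞)₄³`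
(`σ̂ i = -i = i³`; the values lie in `{0} ∪ μ₄`). [cite: IrelandRosen1982, Ch. 9 §8, Prop. 9.8.3 (c); Ch. 14 §2, Prop. 14.2.4] -/
theorem galRestrict_quarticSymbol {σ : K ≃ₐ[ℚ] K} (hσ : σ ≠ 1) (𝔞 : Ideal (𝓞 K)) (β : 𝓞 K) :
    galRestrict ℤ ℚ K (𝓞 K) σ (quarticSymbol 𝔞 β) = quarticSymbol 𝔞 β ^ 3 := by
  apply FaithfulSMul.algebraMap_injective (𝓞 K) K
  rw [algebraMap_galRestrict_apply]
  exact algEquiv_apply_eq_pow_three_of_pow_four hζ hσ _ (quarticSymbol_eq_zero_or_pow_four_eq_one hζ 𝔞 β)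

/-- `χ_{σ̂α}(σ̂β) = χ_α(β)³` over `ℚ(i)` («`\overline{χ_π(α)} = χ_{π̄}(ᾱ)`», Prop. 9.8.3 (c), for the composite symbol).
[cite: IrelandRosen1982, Ch. 9 §8, Prop. 9.8.3 (c); Ch. 14 §2, Prop. 14.2.4] -/
theorem quarticSymbol_span_galRestrict {σ : K ≃ₐ[ℚ] K} (hσ : σ ≠ 1) (α β : 𝓞 K) :
    quarticSymbol (Ideal.span {galRestrict ℤ ℚ K (𝓞 K) σ α}) (galRestrict ℤ ℚ K (𝓞 K) σ β) =
      quarticSymbol (Ideal.span {α}) β ^ 3 := by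
  rw [← galRestrict_quarticSymbol hζ hσ]
  exact quarticSymbol_span_map_ringEquiv hζ (galRestrict ℤ ℚ K (𝓞 K) σ).toRingEquiv α β

end Gaussian

-- `K : Type` below: the splitting of `p ≡ 1 (4)` used by `quarticSymbol_span_natCast_of_mod_four_eq_one` is stated in `Type`.

section GaussianType

variable {K : Type} [Field K] [NumberField K] [IsCyclotomicExtension {4} ℚ K]
variable {ζ : 𝓞 K} (hζ : IsPrimitiveRoot ζ 4)
include hζ

/-- **`χ_a(α) ∈ {0, 1}` for `a ∈ ℤ` odd and `α ∈ ℤ`** — Prop. 9.8.5 («`χ_a(α) = 1`» when `(a, α) = 1`) read without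
the coprimality hypothesis: its proof gives `χ_q(α) ∈ {0, 1}` for `q ≡ 3 (4)` (Prop. 9.8.4, or `0` if `q ∣ α`) and
`χ_p(α) = χ_π(α) \overline{χ_π(α)} = χ_π(α)⁴ ∈ {0, 1}` for `p = π π̄ ≡ 1 (4)`; units and products preserve `{0, 1}`.
[cite: IrelandRosen1982, Ch. 9 §8, Prop. 9.8.5 (proof)] -/
theorem quarticSymbol_span_intCast_intCast_eq_zero_or_eq_one {a : ℤ} (ha : Odd a) (α : ℤ) :
    quarticSymbol (Ideal.span {(a : 𝓞 K)}) (α : 𝓞 K) = 0 ∨ quarticSymbol (Ideal.span {(a : 𝓞 K)}) (α : 𝓞 K) = 1 := by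
  classical
  obtain ⟨σ, hσ⟩ := _root_.Literature.NumberTheory.NumberFields.exists_algEquiv_ne_one_four (K := K)
  suffices h : ∀ n : ℕ, Odd n →
      quarticSymbol (Ideal.span {(n : 𝓞 K)}) (α : 𝓞 K) = 0 ∨ quarticSymbol (Ideal.span {(n : 𝓞 K)}) (α : 𝓞 K) = 1 by
    have hn : Odd a.natAbs := Int.natAbs_odd.mpr ha
    rcases Int.natAbs_eq a with h' | h'
    · rw [h', Int.cast_natCast]; exact h _ hn
    · rw [h', Int.cast_neg, Int.cast_natCast, quarticSymbol_span_neg]; exact h _ hn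
  intro n
  induction n using Nat.recOnMul with
  | zero => intro h0; exact absurd h0 (by decide)
  | one => intro _; rw [Nat.cast_one, quarticSymbol_span_of_isUnit isUnit_one]; exact Or.inr rfl
  | prime p hp =>
    intro hodd
    have hp2 : p ≠ 2 := by rintro rfl; exact absurd hodd (by decide)
    rcases Nat.odd_mod_four_iff.mp (Nat.odd_iff.mp hodd) with h1 | h3
    · obtain ⟨𝔭, -, -, h⟩ := quarticSymbol_span_natCast_of_mod_four_eq_one hζ hσ hp h1 (α : 𝓞 K)
      have hσα : galRestrict ℤ ℚ K (𝓞 K) σ (α : 𝓞 K) = α := map_intCast _ _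
      rw [h, hσα, ← pow_succ']
      rcases quarticResidueSymbol_eq_zero_or_pow_four hζ 𝔭 (Ideal.Quotient.mk 𝔭.asIdeal (α : 𝓞 K)) with h0 | h4
      · exact Or.inl (by rw [h0, zero_pow four_ne_zero])
      · exact Or.inr h4
    · rw [quarticSymbol_span_of_span_eq (inertPlace_asIdeal hp h3)]
      by_cases hpα : (p : ℤ) ∣ α
      · left
        have : Ideal.Quotient.mk (inertPlace hp h3).asIdeal (α : 𝓞 K) = 0 := by
          rw [Ideal.Quotient.eq_zero_iff_mem, inertPlace_asIdeal, Ideal.mem_span_singleton]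
          obtain ⟨c, hc⟩ := hpα
          exact ⟨c, by rw [hc]; push_cast; ring⟩
        rw [this, quarticResidueSymbol_zero hζ]
      · right
        exact quarticResidueSymbol_intCast_eq_one_of_residueCard_eq_sq hζ hp h3
          (show (p : 𝓞 K) ∈ (inertPlace hp h3).asIdeal from Ideal.mem_span_singleton_self _)
          (residueCard_inertPlace hp h3) hpα
  | mul m n ihm ihn =>
    intro hodd
    have hm : Odd m := (Nat.odd_mul.mp hodd).1
    have hn : Odd n := (Nat.odd_mul.mp hodd).2
    have hm0 : (m : 𝓞 K) ≠ 0 := by exact_mod_cast hm.pos.ne'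
    have hn0 : (n : 𝓞 K) ≠ 0 := by exact_mod_cast hn.pos.ne'
    rw [Nat.cast_mul, quarticSymbol_span_mul hm0 hn0]
    rcases ihm hm with h0 | h1
    · exact Or.inl (by rw [h0, zero_mul])
    rcases ihn hn with h0' | h1'
    · exact Or.inl (by rw [h0', mul_zero])
    · exact Or.inr (by rw [h1, h1', one_mul])

end GaussianType

end Literature.NumberTheory.GaloisRepresentations

end
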